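import Summits.Ventures.HodgeRepro2.T5HeckeConvolution

/-!
# The anti-involution `f ↦ f^∨` of `H(G, K)` without Haar measure

The Hecke algebra of `K`-bi-invariant functions carries the anti-involution `f^∨(g) = f(g⁻¹)`,
`(f₁ * f₂)^∨ = f₂^∨ * f₁^∨`, which sends the double coset `1_{KgK}` to `1_{Kg⁻¹K}`.  In the
Haar-free model of `T5HeckePermutationModule` / `T5HeckeConvolution` an element of `H(G, K)` is
a `K`-invariant vector `t ∈ k[G/K]^K` (its value at `δ_K`), i.e. a function on `K∖G/K`, and
`t^∨(xK) := t(x⁻¹K)`.  This file proves: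

* `t^∨` is well defined (lift-independent for `K`-invariant `t`) and finitely supported as soon
  as every double coset `KgK/K` is finite (e.g. `K` compact open): `transpose`;
* `t^∨` is again `K`-invariant, `t^∨^∨ = t`, `δ_K^∨ = δ_K`, `(1_{KgK})^∨ = 1_{Kg⁻¹K}`;
* THE ANTI-HOMOMORPHISM PROPERTY `(t * s)^∨ = s^∨ * t^∨` for the convolution product of
  `T5HeckeConvolution` (a reindexing `xK ↦ z·xK` of the finite sum);
* the same on the algebra `H(G, K) = End_G(k[G/K])`: `transposeOp (T * S) = transposeOp S * transposeOp T`,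
  `transposeOp 1 = 1`, `transposeOp ∘ transposeOp = id`, `transposeOp T_g = T_{g⁻¹}`.

No Haar measure, no topology beyond the finiteness of the double cosets modulo `K`.
-/

namespace Summit.Ventures.HodgeRepro2.T5HeckeTranspose

open T5HeckePermutationModule T5HeckeDoubleCoset T5HeckeDoubleCosetBasis T5HeckeConvolution
  LevelPositivity

variable {G : Type*} [Group G] {k : Type*} [Field k] {K : Subgroup G}

/-- The function `xK ↦ t(x⁻¹K)`, with `x = Quotient.out xK`. -/
noncomputable def invCoeff (t : MonoidAlgebra k (G ⧸ K)) (x : G ⧸ K) : k :=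
  t.coeff ((((Quotient.out x)⁻¹ : G) : G ⧸ K))

/-- Lift independence for `K`-invariant `t`: `invCoeff t (xK) = t(x⁻¹K)` for ANY representative. -/
theorem invCoeff_mk {t : MonoidAlgebra k (G ⧸ K)}
    (ht : t ∈ invariants (Representation.ofMulAction k G (G ⧸ K)) K) (x : G) :
    invCoeff t (x : G ⧸ K) = t.coeff ((x⁻¹ : G) : G ⧸ K) := by
  unfold invCoeff
  have h := coeff_inv_out_smul ht x ((1 : G) : G ⧸ K)
  rw [MulAction.Quotient.smul_mk, smul_eq_mul, mul_one, MulAction.Quotient.smul_mk, smul_eq_mul,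
    mul_one] at h
  exact h

/-- A coset `xK` with `x⁻¹K = yK` lies in the double coset `K y⁻¹ K` (mod `K`). -/
theorem mem_orbit_inv_of_inv_eq {x y : G} (h : ((x⁻¹ : G) : G ⧸ K) = (y : G ⧸ K)) :
    (x : G ⧸ K) ∈ MulAction.orbit K ((y⁻¹ : G) : G ⧸ K) := by
  have hκ : (x⁻¹)⁻¹ * y ∈ K := QuotientGroup.eq.1 h
  rw [inv_inv] at hκ
  refine ⟨⟨x * y, hκ⟩, ?_⟩
  show (x * y) • ((y⁻¹ : G) : G ⧸ K) = (x : G ⧸ K)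
  rw [MulAction.Quotient.smul_mk, smul_eq_mul, mul_assoc, mul_inv_cancel, mul_one]

/-- The support of `invCoeff t` lies in the union of the double cosets `K y⁻¹ K / K`,
`yK` running over the (finite) support of `t`. -/
theorem support_invCoeff_subset (t : MonoidAlgebra k (G ⧸ K)) :
    Function.support (invCoeff t) ⊆
      ⋃ s ∈ t.coeff.support, MulAction.orbit K ((((Quotient.out s)⁻¹ : G)) : G ⧸ K) := by
  intro x hx
  rw [Function.mem_support] at hx
  rw [Set.mem_iUnion₂]
  refine ⟨(((Quotient.out x)⁻¹ : G) : G ⧸ K), Finsupp.mem_support_iff.2 hx, ?_⟩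
  have h : (((Quotient.out x)⁻¹ : G) : G ⧸ K) =
      (((Quotient.out ((((Quotient.out x)⁻¹ : G)) : G ⧸ K) : G)) : G ⧸ K) :=
    (QuotientGroup.out_eq' _).symm
  have h' := mem_orbit_inv_of_inv_eq (K := K) h
  rwa [QuotientGroup.out_eq'] at h'

/-- If every double coset `KgK/K` is finite, `invCoeff t` is finitely supported. -/
theorem finite_support_invCoeff (hK : ∀ g : G, Finite (MulAction.orbit K (g : G ⧸ K)))
    (t : MonoidAlgebra k (G ⧸ K)) : (Function.support (invCoeff t)).Finite := by
  refine Set.Finite.subset ?_ (support_invCoeff_subset t)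
  refine Set.Finite.biUnion (Finset.finite_toSet _) fun s _ => ?_
  haveI := hK ((Quotient.out s)⁻¹)
  exact Set.toFinite _

/-- THE TRANSPOSE `t^∨`, `t^∨(xK) = t(x⁻¹K)`, for a group `G` all of whose double cosets
`KgK/K` are finite (e.g. `K` compact open in a topological group). -/
noncomputable def transpose (hK : ∀ g : G, Finite (MulAction.orbit K (g : G ⧸ K)))
    (t : MonoidAlgebra k (G ⧸ K)) : MonoidAlgebra k (G ⧸ K) :=
  MonoidAlgebra.ofCoeff (Finsupp.ofSupportFinite (invCoeff t) (finite_support_invCoeff hK t))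

variable (hK : ∀ g : G, Finite (MulAction.orbit K (g : G ⧸ K)))

/-- The coefficients of the transpose. -/
theorem coeff_transpose (t : MonoidAlgebra k (G ⧸ K)) (x : G ⧸ K) :
    (transpose hK t).coeff x = t.coeff ((((Quotient.out x)⁻¹ : G)) : G ⧸ K) := by
  unfold transpose
  rw [MonoidAlgebra.coeff_ofCoeff, Finsupp.ofSupportFinite_coe]
  rfl

/-- `t^∨(xK) = t(x⁻¹K)` for any representative `x`, when `t` is `K`-invariant. -/
theorem coeff_transpose_mk {t : MonoidAlgebra k (G ⧸ K)}
    (ht : t ∈ invariants (Representation.ofMulAction k G (G ⧸ K)) K) (x : G) :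
    (transpose hK t).coeff (x : G ⧸ K) = t.coeff ((x⁻¹ : G) : G ⧸ K) := by
  unfold transpose
  rw [MonoidAlgebra.coeff_ofCoeff, Finsupp.ofSupportFinite_coe, invCoeff_mk ht]

/-- The transpose of a `K`-invariant vector at a translate `z • xK`: `t^∨(z x K) = t(x⁻¹ z⁻¹ K)`. -/
theorem coeff_transpose_smul {t : MonoidAlgebra k (G ⧸ K)}
    (ht : t ∈ invariants (Representation.ofMulAction k G (G ⧸ K)) K) (z : G) (x : G ⧸ K) :
    (transpose hK t).coeff (z • x) = t.coeff ((((Quotient.out x)⁻¹ * z⁻¹ : G)) : G ⧸ K) := by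
  conv_lhs => rw [← QuotientGroup.out_eq' x, MulAction.Quotient.smul_mk, smul_eq_mul]
  rw [coeff_transpose_mk hK ht, mul_inv_rev]

/-- The transpose of a `K`-invariant vector at `(out yK)⁻¹ · zK` is `s(z⁻¹ y K)`. -/
theorem coeff_transpose_inv_out_smul {s : MonoidAlgebra k (G ⧸ K)}
    (hs : s ∈ invariants (Representation.ofMulAction k G (G ⧸ K)) K) (z : G) (y : G ⧸ K) :
    (transpose hK s).coeff ((Quotient.out y)⁻¹ • (z : G ⧸ K)) = s.coeff (z⁻¹ • y) := by
  rw [MulAction.Quotient.smul_mk, smul_eq_mul, coeff_transpose_mk hK hs, mul_inv_rev, inv_inv,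
    ← smul_eq_mul, ← MulAction.Quotient.smul_mk, QuotientGroup.out_eq']

/-- `t^∨` is `K`-invariant for `K`-invariant `t` (right translation by `K` does not change
a coset). -/
theorem transpose_mem_invariants {t : MonoidAlgebra k (G ⧸ K)}
    (ht : t ∈ invariants (Representation.ofMulAction k G (G ⧸ K)) K) :
    transpose hK t ∈ invariants (Representation.ofMulAction k G (G ⧸ K)) K := by
  rw [mem_invariants_ofMulAction_iff]
  intro κ hκ x
  conv_lhs => rw [← QuotientGroup.out_eq' x, MulAction.Quotient.smul_mk, smul_eq_mul]
  conv_rhs => rw [← QuotientGroup.out_eq' x]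
  rw [coeff_transpose_mk hK ht, coeff_transpose_mk hK ht, mul_inv_rev]
  congr 1
  rw [QuotientGroup.eq, mul_inv_rev, inv_inv, inv_inv, mul_assoc, mul_inv_cancel, mul_one]
  exact hκ

/-- `t^∨^∨ = t` for `K`-invariant `t`. -/
theorem transpose_transpose {t : MonoidAlgebra k (G ⧸ K)}
    (ht : t ∈ invariants (Representation.ofMulAction k G (G ⧸ K)) K) :
    transpose hK (transpose hK t) = t := by
  apply MonoidAlgebra.ext
  ext x
  rw [coeff_transpose, coeff_transpose_mk hK ht, inv_inv, QuotientGroup.out_eq']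

/-- The transpose is additive. -/
theorem transpose_add (t s : MonoidAlgebra k (G ⧸ K)) :
    transpose hK (t + s) = transpose hK t + transpose hK s := by
  apply MonoidAlgebra.ext
  ext x
  rw [MonoidAlgebra.coeff_add, Finsupp.add_apply, coeff_transpose, coeff_transpose, coeff_transpose,
    MonoidAlgebra.coeff_add, Finsupp.add_apply]

/-- The transpose is `k`-linear. -/
theorem transpose_smul (c : k) (t : MonoidAlgebra k (G ⧸ K)) :
    transpose hK (c • t) = c • transpose hK t := by
  apply MonoidAlgebra.ext
  ext x
  rw [MonoidAlgebra.coeff_smul, Finsupp.smul_apply, coeff_transpose, coeff_transpose,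
    MonoidAlgebra.coeff_smul, Finsupp.smul_apply]

/-- `δ_K^∨ = δ_K`. -/
theorem transpose_single_one :
    transpose hK (MonoidAlgebra.single ((1 : G) : G ⧸ K) (1 : k)) =
      MonoidAlgebra.single ((1 : G) : G ⧸ K) (1 : k) := by
  classical
  apply MonoidAlgebra.ext
  ext x
  rw [coeff_transpose, MonoidAlgebra.coeff_single, Finsupp.single_apply, Finsupp.single_apply]
  have key : (((1 : G) : G ⧸ K) = (((Quotient.out x)⁻¹ : G) : G ⧸ K)) ↔
      (((1 : G) : G ⧸ K) = x) := by
    conv_rhs => rw [← QuotientGroup.out_eq' x]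
    rw [QuotientGroup.eq, QuotientGroup.eq, inv_one, one_mul, one_mul, K.inv_mem_iff]
  simp only [key]

/-- `x⁻¹K ∈ KgK/K → xK ∈ Kg⁻¹K/K`. -/
theorem mem_orbit_inv_of_mem {x g : G}
    (h : ((x⁻¹ : G) : G ⧸ K) ∈ MulAction.orbit K (g : G ⧸ K)) :
    (x : G ⧸ K) ∈ MulAction.orbit K ((g⁻¹ : G) : G ⧸ K) := by
  obtain ⟨κ, hκ⟩ := h
  have hκ' : (κ : G) • (g : G ⧸ K) = ((x⁻¹ : G) : G ⧸ K) := hκ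
  rw [MulAction.Quotient.smul_mk, smul_eq_mul] at hκ'
  have h2 := mem_orbit_inv_of_inv_eq (K := K) hκ'.symm
  rw [mul_inv_rev] at h2
  have e : (((g⁻¹ * (κ : G)⁻¹ : G)) : G ⧸ K) = ((g⁻¹ : G) : G ⧸ K) := by
    rw [QuotientGroup.eq]
    simp only [mul_inv_rev, inv_inv]
    rw [mul_assoc, mul_inv_cancel, mul_one]
    exact κ.2
  rwa [e] at h2

/-- `x⁻¹K ∈ KgK/K ↔ xK ∈ Kg⁻¹K/K`. -/
theorem mem_orbit_inv_iff (x g : G) :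
    ((x⁻¹ : G) : G ⧸ K) ∈ MulAction.orbit K (g : G ⧸ K) ↔
      (x : G ⧸ K) ∈ MulAction.orbit K ((g⁻¹ : G) : G ⧸ K) := by
  refine ⟨mem_orbit_inv_of_mem, fun h => ?_⟩
  have h' := mem_orbit_inv_of_mem (K := K) (x := x⁻¹) (g := g⁻¹) (by rwa [inv_inv])
  rwa [inv_inv] at h'

/-- `(1_{KgK})^∨ = 1_{Kg⁻¹K}`: the transpose of a double coset is the inverse double coset. -/
theorem transpose_orbitVector (g : G) :
    transpose hK (orbitVector k K (MulAction.orbit K (g : G ⧸ K))) =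
      orbitVector k K (MulAction.orbit K ((g⁻¹ : G) : G ⧸ K)) := by
  classical
  haveI := hK g
  haveI := hK g⁻¹
  apply MonoidAlgebra.ext
  ext x
  conv_lhs => rw [← QuotientGroup.out_eq' x]
  conv_rhs => rw [← QuotientGroup.out_eq' x]
  rw [coeff_transpose_mk hK (orbitVector_orbit_mem_invariants k K g),
    coeff_orbitVector_eq_ite (Set.toFinite _), coeff_orbitVector_eq_ite (Set.toFinite _)]
  simp only [mem_orbit_inv_iff]

/-- THE ANTI-HOMOMORPHISM PROPERTY: `(t * s)^∨ = s^∨ * t^∨` for `K`-invariant `t`, `s`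
(the sum over `xK ∈ G/K` is reindexed by `xK ↦ z x K`). -/
theorem transpose_conv {t s : MonoidAlgebra k (G ⧸ K)}
    (ht : t ∈ invariants (Representation.ofMulAction k G (G ⧸ K)) K)
    (hs : s ∈ invariants (Representation.ofMulAction k G (G ⧸ K)) K) :
    transpose hK (conv t s) = conv (transpose hK s) (transpose hK t) := by
  apply MonoidAlgebra.ext
  ext x
  conv_lhs => rw [← QuotientGroup.out_eq' x]
  conv_rhs => rw [← QuotientGroup.out_eq' x]
  set z : G := Quotient.out x
  rw [coeff_transpose_mk hK (conv_mem_invariants ht hs) z, coeff_conv, coeff_conv]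
  simp only [Finsupp.sum]
  have hf : ∀ y : G ⧸ K, s.coeff y * t.coeff ((Quotient.out y)⁻¹ • ((z⁻¹ : G) : G ⧸ K)) =
      s.coeff y * (transpose hK t).coeff (z • y) := by
    intro y
    rw [coeff_transpose_smul hK ht, MulAction.Quotient.smul_mk, smul_eq_mul]
  rw [Finset.sum_congr rfl fun y _ => hf y]
  refine Finset.sum_bij_ne_zero (fun y _ _ => z • y) ?_ ?_ ?_ ?_
  · intro y _ hne
    rw [Finsupp.mem_support_iff]
    exact right_ne_zero_of_mul hne
  · intro y₁ _ _ y₂ _ _ h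
    exact (smul_left_cancel_iff z).1 h
  · intro y _ hne
    rw [coeff_transpose_inv_out_smul hK hs] at hne
    refine ⟨z⁻¹ • y, ?_, ?_, smul_inv_smul z y⟩
    · rw [Finsupp.mem_support_iff]
      exact right_ne_zero_of_mul hne
    · rw [smul_inv_smul]
      exact mul_ne_zero (right_ne_zero_of_mul hne) (left_ne_zero_of_mul hne)
  · intro y _ _
    rw [coeff_transpose_inv_out_smul hK hs, inv_smul_smul, mul_comm]

/-- The value of `T ∈ H(G, K)` at `δ_K` is `K`-invariant. -/
theorem apply_single_one_mem_invariants (T : heckeAlgebra k K) :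
    (T : Module.End k (MonoidAlgebra k (G ⧸ K))) (MonoidAlgebra.single ((1 : G) : G ⧸ K) (1 : k)) ∈
      invariants (Representation.ofMulAction k G (G ⧸ K)) K := by
  rw [← heckeAlgebraEquivInvariants_apply]
  exact Subtype.coe_prop _

/-- THE TRANSPOSE ON `H(G, K) = End_G(k[G/K])`: `T ↦ (T δ_K)^∨`, read back through
`H(G, K) ≃ k[G/K]^K`. -/
noncomputable def transposeOp (T : heckeAlgebra k K) : heckeAlgebra k K :=
  heckeAlgebraEquivInvariants.symm
    ⟨transpose hK (heckeAlgebraEquivInvariants T),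
      transpose_mem_invariants hK (Subtype.coe_prop _)⟩

/-- `(transposeOp T)(δ_K) = (T δ_K)^∨`. -/
theorem transposeOp_apply_single_one (T : heckeAlgebra k K) :
    (transposeOp hK T : Module.End k (MonoidAlgebra k (G ⧸ K)))
        (MonoidAlgebra.single ((1 : G) : G ⧸ K) (1 : k)) =
      transpose hK ((T : Module.End k (MonoidAlgebra k (G ⧸ K)))
        (MonoidAlgebra.single ((1 : G) : G ⧸ K) (1 : k))) := by
  rw [← heckeAlgebraEquivInvariants_apply, transposeOp, LinearEquiv.apply_symm_apply]
  show transpose hK (heckeAlgebraEquivInvariants T : MonoidAlgebra k (G ⧸ K)) = _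
  rw [heckeAlgebraEquivInvariants_apply]

/-- Two elements of `H(G, K)` with the same value at `δ_K` are equal. -/
theorem ext_of_apply_single_one {T S : heckeAlgebra k K}
    (h : (T : Module.End k (MonoidAlgebra k (G ⧸ K)))
        (MonoidAlgebra.single ((1 : G) : G ⧸ K) (1 : k)) =
      (S : Module.End k (MonoidAlgebra k (G ⧸ K)))
        (MonoidAlgebra.single ((1 : G) : G ⧸ K) (1 : k))) : T = S := by
  apply heckeAlgebraEquivInvariants.injective
  apply Subtype.ext
  rw [heckeAlgebraEquivInvariants_apply, heckeAlgebraEquivInvariants_apply, h]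

/-- THE ANTI-INVOLUTION OF `H(G, K)`: `transposeOp (T * S) = transposeOp S * transposeOp T`. -/
theorem transposeOp_mul (T S : heckeAlgebra k K) :
    transposeOp hK (T * S) = transposeOp hK S * transposeOp hK T := by
  apply ext_of_apply_single_one
  rw [transposeOp_apply_single_one, mul_apply_single_one_eq_conv, mul_apply_single_one_eq_conv,
    transposeOp_apply_single_one, transposeOp_apply_single_one]
  exact transpose_conv hK (apply_single_one_mem_invariants T) (apply_single_one_mem_invariants S)

/-- `transposeOp 1 = 1`. -/
theorem transposeOp_one : transposeOp hK (1 : heckeAlgebra k K) = 1 := by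
  apply ext_of_apply_single_one
  rw [transposeOp_apply_single_one, one_apply_single_one, transpose_single_one]

/-- `transposeOp` is an involution. -/
theorem transposeOp_transposeOp (T : heckeAlgebra k K) :
    transposeOp hK (transposeOp hK T) = T := by
  apply ext_of_apply_single_one
  rw [transposeOp_apply_single_one, transposeOp_apply_single_one,
    transpose_transpose hK (apply_single_one_mem_invariants T)]

/-- `transposeOp` is additive. -/
theorem transposeOp_add (T S : heckeAlgebra k K) :
    transposeOp hK (T + S) = transposeOp hK T + transposeOp hK S := by
  apply ext_of_apply_single_one
  rw [transposeOp_apply_single_one, Subalgebra.coe_add, LinearMap.add_apply, transpose_add,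
    Subalgebra.coe_add, LinearMap.add_apply, transposeOp_apply_single_one,
    transposeOp_apply_single_one]

/-- `transposeOp` is `k`-linear. -/
theorem transposeOp_smul (c : k) (T : heckeAlgebra k K) :
    transposeOp hK (c • T) = c • transposeOp hK T := by
  apply ext_of_apply_single_one
  rw [transposeOp_apply_single_one, Subalgebra.coe_smul, LinearMap.smul_apply, transpose_smul,
    Subalgebra.coe_smul, LinearMap.smul_apply, transposeOp_apply_single_one]

/-- `transposeOp T_g = T_{g⁻¹}`: the anti-involution sends the double coset `KgK` to `Kg⁻¹K`. -/
theorem transposeOp_doubleCosetOp (g : G) [Finite (MulAction.orbit K (g : G ⧸ K))]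
    [Finite (MulAction.orbit K ((g⁻¹ : G) : G ⧸ K))] :
    transposeOp hK (doubleCosetOp k K g) = doubleCosetOp k K g⁻¹ := by
  apply ext_of_apply_single_one
  rw [transposeOp_apply_single_one, doubleCosetOp_apply_single_one, doubleCosetOp_apply_single_one,
    transpose_orbitVector]

end Summit.Ventures.HodgeRepro2.T5HeckeTranspose
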